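import Mathlib

/-!
# Nonnegative eigenvectors of Z-matrices: zero propagation (discrete Hopf lemma), and its failure
# under a positive rank-one perturbation

Topic `Literature/Analysis/Matrix`. A real square matrix `A` is a Z-MATRIX when its off-diagonal
entries are nonpositive (`A i j ≤ 0` for `i ≠ j`; the diagonal is arbitrary, so `A + D` is again a
Z-matrix for every diagonal `D`). For `s` large `s • 1 - A` is entrywise nonnegative, so the
Perron–Frobenius theorem applies: an IRREDUCIBLE Z-matrix has a simple bottom eigenvalue with an
entrywise POSITIVE eigenvector and every nonnegative eigenvector is a multiple of it
(Berman–Plemmons, Ch. 2 Thm (1.4)(b) [PDF p.27]; a singular irreducible M-matrix has a kernel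
vector `x ≫ 0`, Ch. 6 Thm (4.16)(2) [PDF p.121]; operator version — the generator of a
positivity-improving semigroup has a strictly positive simple ground state — Reed–Simon IV
Thm XIII.44 [PDF p.197]).

This file records the LOCAL mechanism behind that positivity and its sharpness.

* `zMatrix_supersolution_offDiag_mul_eq_zero` — the discrete strong maximum principle / Hopf
  lemma: if `A` is a Z-matrix, `u ≥ 0`, `u i = 0` and `u` is a SUPERSOLUTION at `i`
  (`0 ≤ (A *ᵥ u) i`; an eigenvector qualifies, `(A *ᵥ u) i = μ * u i = 0`, whatever the sign of
  `μ`), then `A i j * u j = 0` for all `j ≠ i`: the vector vanishes at every node COUPLED to `i`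
  (`A i j < 0`; `zMatrix_supersolution_zero_of_coupled`, `zMatrix_eigenvector_zero_of_coupled`).
  Iterated along the coupling graph this is the positivity assertion of Perron–Frobenius for
  irreducible `A`: a nonnegative eigenvector is either everywhere positive or zero.
* `exists_zMatrix_add_rankOne_groundState_boundary_zero` — the Z-sign hypothesis cannot be relaxed
  by a POSITIVE RANK-ONE term. There is a `3 × 3` Z-matrix `A` with connected coupling graph
  `0 — 2 — 1` (node `0` is a boundary node: coupled to node `2` only) and an entrywise positive
  vector `c` such that: for `A` itself a nonnegative eigenvector vanishing at the boundary node is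
  zero, while `M = A + c cᵀ` is positive semidefinite with kernel the line spanned by
  `u = (0, 1, 1)` — the bottom eigenvector of `M` is simple, nonnegative, positive at the interior
  nodes and ZERO exactly at the boundary node. Explicitly `A = !![1, 0, -2; 0, 0, -2; -2, -2, 0]`,
  `c = (1, 1, 1)`, `M = !![2, 1, -1; 1, 1, -1; -1, -1, 1] = Bᵀ B`, `B = !![1, 1, -1; 1, 0, 0]`.

* `exists_zMatrix_add_rankOne_groundState_zero_pos_energy` — the same failure with COMPLETE
  coupling graph and POSITIVE bottom energy: `A = !![1, -1, -1; -1, 1, -2; -1, -2, 1]` (every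
  off-diagonal entry negative, so for `A` alone a nonnegative eigenvector with ANY zero vanishes),
  `c = (1, 1, 1)`, `M = A + c cᵀ = !![2, 0, 0; 0, 2, -1; 0, -1, 2]`: the bottom eigenvalue of `M` is
  `1 > 0`, SIMPLE, with eigenvector `u = (0, 1, 1)` — nonnegative and zero exactly at node `0`
  (`M − 1 = Bᵀ B`, `B = !![1, 0, 0; 0, 1, -1]`). In the class "Z-matrix + positive rank-one term" a
  one-signed simple ground state with a node thus occurs at positive as well as at zero energy.

[cite: BermanPlemmons1979, Ch. 2 Thm (1.4)(b) p.27 and Ch. 6 Thm (4.16) p.121;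
ReedSimonIV1978, Thm XIII.44 p.197]

No definitions, no named facts; finite sums and two explicit factorisations.
-/

namespace Literature.Analysis.Matrix

open _root_.Matrix Finset

variable {n : Type*} [Fintype n] [DecidableEq n]

/-- **Discrete strong maximum principle for Z-matrices.** If the off-diagonal entries of `A` are
nonpositive, `u ≥ 0` vanishes at `i` and is a supersolution there (`0 ≤ (A *ᵥ u) i`), then every
off-diagonal product `A i j * u j` (`j ≠ i`) vanishes.
[cite: BermanPlemmons1979, Ch. 2 Thm (1.4)(b) p.27] -/
theorem zMatrix_supersolution_offDiag_mul_eq_zero (A : Matrix n n ℝ)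
    (hZ : ∀ i j, i ≠ j → A i j ≤ 0) {u : n → ℝ} (hu : ∀ j, 0 ≤ u j) {i : n} (hi : u i = 0)
    (hsuper : 0 ≤ (A *ᵥ u) i) : ∀ j, j ≠ i → A i j * u j = 0 := by
  have hsum : (A *ᵥ u) i = ∑ j, A i j * u j := rfl
  have hterm : ∀ j ∈ (univ : Finset n), A i j * u j ≤ 0 := by
    intro j _
    by_cases hji : j = i
    · rw [hji, hi, mul_zero]
    · exact mul_nonpos_of_nonpos_of_nonneg (hZ i j (fun h ↦ hji h.symm)) (hu j)
  have hle : ∑ j, A i j * u j ≤ 0 := sum_nonpos hterm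
  have hzero : ∑ j, A i j * u j = 0 := le_antisymm hle (hsum ▸ hsuper)
  have hall := (sum_eq_zero_iff_of_nonpos hterm).mp hzero
  intro j hji
  exact hall j (mem_univ j)

/-- **Zero propagation to coupled nodes (discrete Hopf lemma).** Under the hypotheses of
`zMatrix_supersolution_offDiag_mul_eq_zero`, `u` vanishes at every node `j` coupled to `i`
(`A i j < 0`). [cite: BermanPlemmons1979, Ch. 6 Thm (4.16) p.121] -/
theorem zMatrix_supersolution_zero_of_coupled (A : Matrix n n ℝ)
    (hZ : ∀ i j, i ≠ j → A i j ≤ 0) {u : n → ℝ} (hu : ∀ j, 0 ≤ u j) {i : n} (hi : u i = 0)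
    (hsuper : 0 ≤ (A *ᵥ u) i) {j : n} (hij : A i j < 0) : u j = 0 := by
  by_cases hji : j = i
  · rw [hji]; exact hi
  have h := zMatrix_supersolution_offDiag_mul_eq_zero A hZ hu hi hsuper j hji
  rcases mul_eq_zero.mp h with h | h
  · exact absurd h (ne_of_lt hij)
  · exact h

/-- **Eigenvector form.** A nonnegative eigenvector of a Z-matrix (any eigenvalue `μ`) that vanishes
at a node vanishes at all nodes coupled to it; for an irreducible Z-matrix it is therefore either
everywhere positive or zero (Perron–Frobenius). [cite: BermanPlemmons1979, Ch. 2 Thm (1.4)(b) p.27;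
ReedSimonIV1978, Thm XIII.44 p.197] -/
theorem zMatrix_eigenvector_zero_of_coupled (A : Matrix n n ℝ)
    (hZ : ∀ i j, i ≠ j → A i j ≤ 0) {u : n → ℝ} (hu : ∀ j, 0 ≤ u j) {μ : ℝ}
    (heig : A *ᵥ u = μ • u) {i : n} (hi : u i = 0) {j : n} (hij : A i j < 0) : u j = 0 := by
  have hsuper : 0 ≤ (A *ᵥ u) i := by
    rw [heig, Pi.smul_apply, smul_eq_mul, hi, mul_zero]
  exact zMatrix_supersolution_zero_of_coupled A hZ hu hi hsuper hij

/-- **Sharpness: a positive rank-one term can put a zero of the ground state at a boundary node.**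
An explicit `3 × 3` Z-matrix `A` (coupling graph `0 — 2 — 1`) and `c = (1,1,1)`: for `A` alone a
nonnegative eigenvector vanishing at node `0` is zero, whereas `A + c cᵀ` is positive semidefinite
with one-dimensional kernel spanned by `(0, 1, 1)`. [cite: BermanPlemmons1979, Ch. 6 Thm (4.16)
p.121 (the unperturbed statement); the perturbed example is elementary] -/
theorem exists_zMatrix_add_rankOne_groundState_boundary_zero :
    ∃ (A : Matrix (Fin 3) (Fin 3) ℝ) (c u : Fin 3 → ℝ),
      (∀ i j, i ≠ j → A i j ≤ 0) ∧ A 0 2 < 0 ∧ A 2 1 < 0 ∧ (∀ i, 0 < c i) ∧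
      (∀ w : Fin 3 → ℝ, (∀ i, 0 ≤ w i) → (∃ μ : ℝ, A *ᵥ w = μ • w) → w 0 = 0 → w = 0) ∧
      (∀ i, 0 ≤ u i) ∧ u 0 = 0 ∧ 0 < u 1 ∧ 0 < u 2 ∧
      (A + vecMulVec c c) *ᵥ u = 0 ∧ (A + vecMulVec c c).PosSemidef ∧
      (∀ x : Fin 3 → ℝ, (A + vecMulVec c c) *ᵥ x = 0 → x = x 1 • u) := by
  have hZ : ∀ i j : Fin 3, i ≠ j →
      (!![1, 0, -2; 0, 0, -2; -2, -2, 0] : Matrix (Fin 3) (Fin 3) ℝ) i j ≤ 0 := by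
    intro i j hij
    fin_cases i <;> fin_cases j <;> simp_all
  have hM : (!![1, 0, -2; 0, 0, -2; -2, -2, 0] : Matrix (Fin 3) (Fin 3) ℝ) +
      vecMulVec ![1, 1, 1] ![1, 1, 1] = !![2, 1, -1; 1, 1, -1; -1, -1, 1] := by
    ext i j
    fin_cases i <;> fin_cases j <;> simp <;> norm_num
  have hB : (!![2, 1, -1; 1, 1, -1; -1, -1, 1] : Matrix (Fin 3) (Fin 3) ℝ) =
      (!![1, 1, -1; 1, 0, 0] : Matrix (Fin 2) (Fin 3) ℝ)ᵀ *
        (!![1, 1, -1; 1, 0, 0] : Matrix (Fin 2) (Fin 3) ℝ) := by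
    ext i j
    fin_cases i <;> fin_cases j <;> norm_num [Matrix.mul_apply, Fin.sum_univ_two]
  refine ⟨!![1, 0, -2; 0, 0, -2; -2, -2, 0], ![1, 1, 1], ![0, 1, 1], hZ, ?_, ?_, ?_, ?_, ?_, ?_,
    ?_, ?_, ?_, ?_, ?_⟩
  · simp
  · simp
  · intro i; fin_cases i <;> simp
  · -- the unperturbed Z-matrix: zero at the boundary node propagates to all nodes
    intro w hw ⟨μ, hμ⟩ hw0
    have h02 : (!![1, 0, -2; 0, 0, -2; -2, -2, 0] : Matrix (Fin 3) (Fin 3) ℝ) 0 2 < 0 := by simp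
    have hw2 : w 2 = 0 := zMatrix_eigenvector_zero_of_coupled _ hZ hw hμ hw0 h02
    have h21 : (!![1, 0, -2; 0, 0, -2; -2, -2, 0] : Matrix (Fin 3) (Fin 3) ℝ) 2 1 < 0 := by simp
    have hw1 : w 1 = 0 := zMatrix_eigenvector_zero_of_coupled _ hZ hw hμ hw2 h21
    ext i; fin_cases i <;> simp [hw0, hw1, hw2]
  · intro i; fin_cases i <;> simp
  · simp
  · simp
  · simp
  · rw [hM]
    ext i; fin_cases i <;> simp [Matrix.mulVec, dotProduct, Fin.sum_univ_three]
  · rw [hM, hB, ← conjTranspose_eq_transpose_of_trivial]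
    exact posSemidef_conjTranspose_mul_self _
  · intro x hx
    rw [hM] at hx
    have h0 := congrFun hx 0
    have h1 := congrFun hx 1
    have h2 := congrFun hx 2
    simp [Matrix.mulVec, dotProduct, Fin.sum_univ_three] at h0 h1 h2
    ext i; fin_cases i <;> simp <;> linarith

/-- **Sharpness with complete coupling and positive bottom energy.** An explicit `3 × 3` Z-matrix
`A` with COMPLETE coupling graph (every off-diagonal entry negative) and `c = (1,1,1)`: for `A`
alone a nonnegative eigenvector vanishing at any node is zero, whereas `M = A + c cᵀ =
!![2, 0, 0; 0, 2, -1; 0, -1, 2]` has bottom eigenvalue `1 > 0`, simple, with eigenvector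
`u = (0, 1, 1)` — nonnegative, positive at nodes `1, 2` and ZERO at node `0` (`M − 1 = Bᵀ B ≥ 0`,
`B = !![1, 0, 0; 0, 1, -1]`, `ker (M − 1) = ℝ u`). [cite: BermanPlemmons1979, Ch. 6 Thm (4.16)
p.121 (the unperturbed statement); the perturbed example is elementary] -/
theorem exists_zMatrix_add_rankOne_groundState_zero_pos_energy :
    ∃ (A : Matrix (Fin 3) (Fin 3) ℝ) (c u : Fin 3 → ℝ),
      (∀ i j, i ≠ j → A i j < 0) ∧ (∀ i, 0 < c i) ∧
      (∀ w : Fin 3 → ℝ, (∀ i, 0 ≤ w i) → (∃ μ : ℝ, A *ᵥ w = μ • w) → (∃ i, w i = 0) → w = 0) ∧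
      (∀ i, 0 ≤ u i) ∧ u 0 = 0 ∧ 0 < u 1 ∧ 0 < u 2 ∧
      (A + vecMulVec c c) *ᵥ u = (1 : ℝ) • u ∧ (A + vecMulVec c c - 1).PosSemidef ∧
      (∀ x : Fin 3 → ℝ, (A + vecMulVec c c) *ᵥ x = (1 : ℝ) • x → x = x 1 • u) := by
  have hZ : ∀ i j : Fin 3, i ≠ j →
      (!![1, -1, -1; -1, 1, -2; -1, -2, 1] : Matrix (Fin 3) (Fin 3) ℝ) i j < 0 := by
    intro i j hij
    fin_cases i <;> fin_cases j <;> simp_all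
  have hZle : ∀ i j : Fin 3, i ≠ j →
      (!![1, -1, -1; -1, 1, -2; -1, -2, 1] : Matrix (Fin 3) (Fin 3) ℝ) i j ≤ 0 :=
    fun i j h ↦ (hZ i j h).le
  have hM : (!![1, -1, -1; -1, 1, -2; -1, -2, 1] : Matrix (Fin 3) (Fin 3) ℝ) +
      vecMulVec ![1, 1, 1] ![1, 1, 1] = !![2, 0, 0; 0, 2, -1; 0, -1, 2] := by
    ext i j
    fin_cases i <;> fin_cases j <;> simp <;> norm_num
  have hM1 : (!![2, 0, 0; 0, 2, -1; 0, -1, 2] : Matrix (Fin 3) (Fin 3) ℝ) - 1 =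
      !![1, 0, 0; 0, 1, -1; 0, -1, 1] := by
    ext i j
    fin_cases i <;> fin_cases j <;> simp <;> norm_num
  have hB : (!![1, 0, 0; 0, 1, -1; 0, -1, 1] : Matrix (Fin 3) (Fin 3) ℝ) =
      (!![1, 0, 0; 0, 1, -1] : Matrix (Fin 2) (Fin 3) ℝ)ᵀ *
        (!![1, 0, 0; 0, 1, -1] : Matrix (Fin 2) (Fin 3) ℝ) := by
    ext i j
    fin_cases i <;> fin_cases j <;> norm_num [Matrix.mul_apply, Fin.sum_univ_two]
  refine ⟨!![1, -1, -1; -1, 1, -2; -1, -2, 1], ![1, 1, 1], ![0, 1, 1], hZ, ?_, ?_, ?_, ?_, ?_, ?_,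
    ?_, ?_, ?_⟩
  · intro i; fin_cases i <;> simp
  · -- the unperturbed Z-matrix: complete coupling, so any zero propagates to all nodes
    intro w hw ⟨μ, hμ⟩ ⟨i, hi⟩
    funext j
    rw [Pi.zero_apply]
    by_cases hji : j = i
    · rw [hji, hi]
    · exact zMatrix_eigenvector_zero_of_coupled _ hZle hw hμ hi (hZ i j (fun h ↦ hji h.symm))
  · intro i; fin_cases i <;> simp
  · simp
  · simp
  · simp
  · rw [hM, one_smul]
    ext i; fin_cases i <;> simp [Matrix.mulVec, dotProduct, Fin.sum_univ_three] <;> norm_num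
  · rw [hM, hM1, hB, ← conjTranspose_eq_transpose_of_trivial]
    exact posSemidef_conjTranspose_mul_self _
  · intro x hx
    have hx' : ((!![1, -1, -1; -1, 1, -2; -1, -2, 1] : Matrix (Fin 3) (Fin 3) ℝ) +
        vecMulVec ![1, 1, 1] ![1, 1, 1] - 1) *ᵥ x = 0 := by
      rw [sub_mulVec, one_mulVec, hx, one_smul, sub_self]
    rw [hM, hM1] at hx'
    have h0 := congrFun hx' 0
    have h1 := congrFun hx' 1
    have h2 := congrFun hx' 2
    simp [Matrix.mulVec, dotProduct, Fin.sum_univ_three] at h0 h1 h2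
    ext i; fin_cases i <;> simp <;> linarith

end Literature.Analysis.Matrix
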